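import Summits.QuantumFields.YangMills.Theorems.FemtoTransferGapZeroModes
import Literature.MathematicalPhysics.QuantumFieldTheory.Balaban1983to89.T4CubeChartGnomonic

/-!
# The gnomonic (projective) link coordinate and PHYSICAL pull-backs of colour-invariant functions on `ℝ⁹`
# (support module for the registered stub `stub_absLower` of crux `OneSiteLevels`, route `LuscherReduction`,
# item stmt-QuantumFields-20007; fleet seat prover ym-luscher-20007-p2)

The quasimode trial states of `stub_absLower` are pull-backs `U ↦ G(gnCoord μ U)` of colour-rotation-invariant functions
`G` on Lüscher's zero-mode space `ZM = ℝ⁹` along the GNOMONIC coordinate of the three links,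
`gnCoord μ U (i,a) = vecPart(U_i)_a / (μ · scalarPart(U_i))` (`U_i = u₀ + i u·σ ↦ u/u₀`, the central projection of
`S³` onto the tangent space at `1`, read at scale `μ`; intended `μ = λ_b/2`).  Why this coordinate:

* it is INVARIANT under the centre, `gn(−W) = gn(W)` (`gnLink_negOne_mul`), so a pull-back is automatically invariant
  under the three centre twists (zero electric flux) — no sum over the `8` torons is needed;
* it is EQUIVARIANT under simultaneous conjugation, `gn(V W V⁻¹) = Ad(V)·gn(W)` with `Ad(V) = adRot V ∈ SO(3)`
  (`gnLink_conj`, from the landed `vecPart_conj` / `scalarPart_conj`), so the pull-back of an `IsGaugeInv` function is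
  gauge invariant;
* normalised Haar measure on `SU(2)` is KNOWN in this chart (tree: `SU2HaarChart.lintegral_haarProbability_su2_gnomonic`,
  density `(2π²)⁻¹(1+|v|²)⁻²` on each hemisphere; packaged as `gnoPoint`/`gnoWeight` in `T4CubeChartGnomonic`), and the
  chart points satisfy `gn(±P(1,v)) = v` exactly (`gnLink_gnoPoint`, `gnLink_negOne_mul_gnoPoint`).

Main result: `isPhys_gnPullback` — for `G : ZM → ℝ` measurable, bounded and `IsGaugeInv`, the function
`U ↦ G (gnCoord μ U)` is a physical zero-flux test function (`IsPhys`).  Plus the sign-pattern chart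
`gnChart μ σ y` (`σ : Fin 3 → Bool` = which links sit in the lower hemisphere) with `gnCoord μ (gnChart μ σ y) = y`.

## WHAT THIS IS NOT
No analysis and no measure theory (that is the sibling `…GnHaar`); NOT the stub, NOT THE CLAY GAP.  Sorry-free, no named fact.
-/

set_option autoImplicit false

noncomputable section

open MeasureTheory Filter Topology Real
open scoped Matrix Quaternion
open Literature.MathematicalPhysics.QuantumFieldTheory
open Literature.MathematicalPhysics.QuantumLattice
open Literature.Analysis.OperatorTheory.YMMatrixModel
open Literature.MathematicalPhysics.QuantumFieldTheory.Balaban1983to89.T4CubeChartGnomonic (gnoPoint gnoWeight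
  su2Quat_gnoPoint re_su2Quat_gnoPoint re_su2Quat_gnoPoint_pos continuous_gnoPoint)

namespace Summit.QuantumFields.YangMills.Theorems.FemtoTransferGap

/-! ### §1. The gnomonic coordinate of one link -/

/-- The gnomonic (central-projection) coordinate of a link: `u/u₀` for `W = u₀ + i u·σ` (junk `0` on the equator `u₀ = 0`,
where Lean's `x / 0 = 0`). [folklore] -/
def gnLink (W : SU2) (a : Fin 3) : ℝ := vecPart W a / scalarPart W

/-- `gnLink` unfolded. [folklore] -/
theorem gnLink_apply (W : SU2) (a : Fin 3) : gnLink W a = vecPart W a / scalarPart W := rfl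

/-- CENTRE INVARIANCE: `gn(−W) = gn(W)` (both parts flip sign). [folklore] -/
theorem gnLink_negOne_mul (W : SU2) : gnLink (negOne * W) = gnLink W := by
  funext a
  rw [gnLink_apply, gnLink_apply, vecPart_negOne_mul, scalarPart_negOne_mul, Pi.neg_apply, neg_div_neg_eq]

/-- EQUIVARIANCE: `gn(V W V⁻¹) = Ad(V)·gn(W)`. [cite: BrockerTomDieck1985, I (1.10)] -/
theorem gnLink_conj (V W : SU2) : gnLink (V * W * V⁻¹) = (adRot V).mulVec (gnLink W) := by
  funext a
  rw [gnLink_apply, vecPart_conj, scalarPart_conj, Matrix.mulVec, Matrix.mulVec, dotProduct, dotProduct,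
    Finset.sum_div]
  refine Finset.sum_congr rfl fun b _ => ?_
  rw [gnLink_apply]
  ring

/-- `gnLink` is measurable (quotient of continuous functions). [folklore] -/
theorem measurable_gnLink_apply (a : Fin 3) : Measurable fun W : SU2 => gnLink W a := by
  haveI := secondCountableTopology_su2
  exact ((continuous_apply a).comp continuous_vecPart).measurable.div continuous_scalarPart.measurable

/-! ### §2. The gnomonic zero-mode coordinates of a one-site configuration -/

/-- The gnomonic zero-mode coordinates at scale `μ`: `x_{(i,a)} = gn(U_i)_a / μ`. [cite: Luscher1983, §2] [cite: Vanbaal2001, §4] -/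
def gnCoord (μ : ℝ) (U : Cfg) : ZM :=
  WithLp.toLp 2 fun p : Fin 3 × Fin 3 => gnLink (U (edgeOf p.1)) p.2 / μ

/-- Coordinates of `gnCoord`. [folklore] -/
@[simp] theorem gnCoord_apply (μ : ℝ) (U : Cfg) (p : Fin 3 × Fin 3) :
    gnCoord μ U p = gnLink (U (edgeOf p.1)) p.2 / μ := rfl

/-- Simultaneous conjugation rotates the gnomonic coordinates by `Ad(V)`. [cite: Vanbaal2001, §4] -/
theorem gnCoord_conj (μ : ℝ) (V : SU2) (U : Cfg) :
    gnCoord μ (fun e => V * U e * V⁻¹) = colourRotate (adRot V) (gnCoord μ U) := by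
  ext p
  rw [gnCoord_apply, gnLink_conj, Matrix.mulVec, dotProduct]
  show _ = ∑ b : Fin 3, adRot V p.2 b * gnCoord μ U (p.1, b)
  simp only [gnCoord_apply]
  rw [Finset.sum_div]
  refine Finset.sum_congr rfl fun b _ => ?_
  ring

/-- Multiplying one link by `−1` does not change the gnomonic coordinates. [folklore] -/
theorem gnCoord_negOne (μ : ℝ) (k : Fin 3) (U : Cfg) :
    gnCoord μ (fun e => if e.2 = k then negOne * U e else U e) = gnCoord μ U := by
  ext p
  simp only [gnCoord_apply]
  by_cases h : (edgeOf p.1).2 = k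
  · rw [if_pos h, gnLink_negOne_mul]
  · rw [if_neg h]

/-- `gnCoord μ` is measurable. [folklore] -/
theorem measurable_gnCoord (μ : ℝ) : Measurable (gnCoord μ) := by
  refine (PiLp.continuous_toLp 2 _).measurable.comp (measurable_pi_lambda _ fun p => ?_)
  exact ((measurable_gnLink_apply p.2).comp (measurable_pi_apply (edgeOf p.1))).div_const μ

/-- **Physical pull-backs along the gnomonic coordinate.**  For `G : ZM → ℝ` measurable, bounded and colour-rotation
invariant, `U ↦ G (gnCoord μ U)` is a physical zero-flux test function of the one-site model: measurable, bounded, gauge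
invariant (conjugation rotates the coordinates by `adRot V ∈ SO(3)`), and twist invariant (the centre `{±1}` does not move
the gnomonic coordinate). [cite: Luscher1983, §2–§3] [cite: Vanbaal2001, §4] -/
theorem isPhys_gnPullback {G : ZM → ℝ} (hGm : Measurable G) (hGb : ∃ C : ℝ, ∀ x, |G x| ≤ C) (hG : IsGaugeInv G)
    (μ : ℝ) : IsPhys (fun U : Cfg => G (gnCoord μ U)) where
  measurable := hGm.comp (measurable_gnCoord μ)
  bounded := by obtain ⟨C, hC⟩ := hGb; exact ⟨C, fun U => hC _⟩
  gaugeInv := fun g U => by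
    show G (gnCoord μ (gaugeTransform g U)) = G (gnCoord μ U)
    rw [gaugeTransform_one_site_eq, gnCoord_conj]
    exact hG _ (adRot_mem_specialOrthogonalGroup _) _
  zeroFlux := fun k z hz U => by
    show G (gnCoord μ (twist k z U)) = G (gnCoord μ U)
    rw [twist_one_site]
    rcases eq_one_or_eq_negOne_of_mem_center hz with rfl | rfl
    · simp
    · rw [gnCoord_negOne]

/-! ### §3. Chart points: `gn(±P(1,v)) = v` -/

/-- `quatToSU2 (−1) = negOne`. [folklore] -/
theorem quatToSU2_neg_one : quatToSU2 (-1 : ℍ) = negOne := by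
  apply Subtype.ext
  rw [coe_quatToSU2 (neg_ne_zero.2 one_ne_zero), norm_neg, norm_one, inv_one, one_smul, quatMatrix_neg, quatMatrix_one,
    coe_negOne]

/-- The antipode of a chart point: `P(−(1,v)) = negOne · P(1,v)`. [folklore] -/
theorem quatToSU2_neg_gnomonicQuat (v : Fin 3 → ℝ) : quatToSU2 (-gnomonicQuat v) = negOne * gnoPoint v := by
  rw [quatToSU2_neg (Literature.MathematicalPhysics.QuantumLattice.gnomonicQuat_ne_zero v), quatToSU2_neg_one]
  rfl

/-- `scalarPart (P(1,v)) = ‖(1,v)‖⁻¹`. [folklore] -/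
theorem scalarPart_gnoPoint (v : Fin 3 → ℝ) : scalarPart (gnoPoint v) = ‖gnomonicQuat v‖⁻¹ :=
  re_su2Quat_gnoPoint v

/-- `0 < scalarPart (P(1,v))`. [folklore] -/
theorem scalarPart_gnoPoint_pos (v : Fin 3 → ℝ) : 0 < scalarPart (gnoPoint v) :=
  re_su2Quat_gnoPoint_pos v

/-- `vecPart (P(1,v)) = ‖(1,v)‖⁻¹ • v`. [folklore] -/
theorem vecPart_gnoPoint (v : Fin 3 → ℝ) (a : Fin 3) : vecPart (gnoPoint v) a = ‖gnomonicQuat v‖⁻¹ * v a := by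
  have h := su2Quat_gnoPoint v
  fin_cases a
  · show (su2Quat (gnoPoint v)).imI = _
    rw [h]; simp [Literature.MathematicalPhysics.QuantumLattice.gnomonicQuat]
  · show (su2Quat (gnoPoint v)).imJ = _
    rw [h]; simp [Literature.MathematicalPhysics.QuantumLattice.gnomonicQuat]
  · show (su2Quat (gnoPoint v)).imK = _
    rw [h]; simp [Literature.MathematicalPhysics.QuantumLattice.gnomonicQuat]

/-- **`gn(P(1,v)) = v`**: the gnomonic coordinate of a chart point is the chart parameter. [folklore] -/
theorem gnLink_gnoPoint (v : Fin 3 → ℝ) : gnLink (gnoPoint v) = v := by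
  funext a
  rw [gnLink_apply, vecPart_gnoPoint, scalarPart_gnoPoint]
  have h : (‖gnomonicQuat v‖⁻¹ : ℝ) ≠ 0 :=
    inv_ne_zero (norm_ne_zero_iff.2 (Literature.MathematicalPhysics.QuantumLattice.gnomonicQuat_ne_zero v))
  exact mul_div_cancel_left₀ _ h

/-- `gn(−P(1,v)) = v` as well (the antipodal hemisphere has the same projective coordinate). [folklore] -/
theorem gnLink_negOne_mul_gnoPoint (v : Fin 3 → ℝ) : gnLink (negOne * gnoPoint v) = v := by
  rw [gnLink_negOne_mul, gnLink_gnoPoint]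

/-! ### §4. The sign-pattern chart of the one-site configuration space -/

/-- The hemisphere sign of a link: `false ↦ 1` (upper hemisphere `u₀ > 0`), `true ↦ −1`. [folklore] -/
def hemi (b : Bool) : SU2 := if b then negOne else 1

/-- `hemi b` is central: it is `1` or `negOne`. [folklore] -/
theorem hemi_eq (b : Bool) : hemi b = 1 ∨ hemi b = negOne := by
  unfold hemi; cases b <;> simp

/-- `gn(hemi b · W) = gn(W)`. [folklore] -/
theorem gnLink_hemi_mul (b : Bool) (W : SU2) : gnLink (hemi b * W) = gnLink W := by
  rcases hemi_eq b with h | h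
  · rw [h, one_mul]
  · rw [h, gnLink_negOne_mul]

/-- **The sign-pattern gnomonic chart** of `SU(2)³` at scale `μ`: link `i` is `hemi(σ_i) · P(1, μ·y_i)`.  For each of the `8`
patterns `σ` this parametrises the product of the corresponding open hemispheres. [folklore] -/
def gnChart (μ : ℝ) (σ : Fin 3 → Bool) (y : ZM) : Cfg :=
  fun e => hemi (σ e.2) * gnoPoint (fun a => μ * y (e.2, a))

/-- The chart inverts the coordinate: `gnCoord μ (gnChart μ σ y) = y` (`μ ≠ 0`). [folklore] -/
theorem gnCoord_gnChart {μ : ℝ} (hμ : μ ≠ 0) (σ : Fin 3 → Bool) (y : ZM) : gnCoord μ (gnChart μ σ y) = y := by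
  ext p
  rw [gnCoord_apply]
  unfold gnChart
  rw [gnLink_hemi_mul, gnLink_gnoPoint]
  simp only [edgeOf]
  field_simp

/-- The chart is measurable in `y`. [folklore] -/
theorem measurable_gnChart (μ : ℝ) (σ : Fin 3 → Bool) : Measurable (gnChart μ σ) := by
  refine measurable_pi_lambda _ fun e => ?_
  have hc : Continuous fun y : ZM => gnoPoint (fun a => μ * y (e.2, a)) := by
    refine continuous_gnoPoint.comp (continuous_pi fun a => ?_)
    exact (continuous_const.mul ((continuous_apply (e.2, a)).comp (PiLp.continuous_ofLp 2 _)))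
  haveI := secondCountableTopology_su2
  exact (continuous_const.mul hc).measurable

/-- The vector part of a chart link: `vecPart((gnChart μ σ y)_e)_a = s · ‖(1, μy_e)‖⁻¹ · μ y_{(e.2,a)}` with `s = ±1`; in
particular its square does not depend on the pattern. [folklore] -/
theorem vecPart_gnChart_sq (μ : ℝ) (σ : Fin 3 → Bool) (y : ZM) (e : Edge 3 1) (a : Fin 3) :
    vecPart (gnChart μ σ y e) a ^ 2 = (‖gnomonicQuat (fun b => μ * y (e.2, b))‖⁻¹ * (μ * y (e.2, a))) ^ 2 := by
  unfold gnChart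
  rcases hemi_eq (σ e.2) with h | h
  · rw [h, one_mul, vecPart_gnoPoint]
  · rw [h, vecPart_negOne_mul, Pi.neg_apply, vecPart_gnoPoint, neg_sq]

end Summit.QuantumFields.YangMills.Theorems.FemtoTransferGap

end
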